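import Mathlib
import HarnessLib
import Summits.NavierStokesRegularity.NavierStokesRegularity.Theses.ExactWindowRungThree
import Summits.NavierStokesRegularity.NavierStokesRegularity.Theses.TrappingWindowRungThree
import Summits.NavierStokesRegularity.NavierStokesRegularity.Theorems.TrappingWindowRungThreeShadowingTransfer
import Summits.NavierStokesRegularity.NavierStokesRegularity.Theorems.TrappingWindowRungThreeTrappingBootstrap

/-!
# `ExactWindowRungThree.TransferBootstrap` (item stmt-NavierStokesRegularity-22416, support S1′)

**Statement.** `ExactFlowCertificate → TailEnvelopes → ∃ ε₀ = 1, R, θ ≤ 1/2, c, η > 0, i₀, α ∈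
InTableClass R, X₀ (X₀ i₀ ≠ 0), P ∋ datum, env` with `RobustStep 1 θ c η i₀ α P env`.

PROOF (two steps, as planned on the item).  Step 1 (pseudo-orbit transfer): the exact-flow
certificate K1a implies the inclusion trapping certificate K1 of the sibling route
`TrappingWindowRungThree` — this is `trappingWindowRungThree_shadowingTransfer_proof`
(item stmt-22924; weighted shadowing in the certified `κ`-tube + first-exit bootstrap).  Step 2: the
sibling's first-exit continuity bootstrap `trappingWindowRungThree_trappingBootstrap_proof`
(item stmt-21749) turns K1 and the tail envelopes K2 into the `RobustStep`.  The two routes render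
`ExactFlowCertificate` (item stmt-22916) and `TailEnvelopes` (item stmt-21748) from the same ledger
items, so the hypotheses of this route are definitionally those of the sibling route.

HONEST FRAMING: glue about Tao-type MODEL lattice ODEs (rung TL-M3); the cruxes K1a and K2 are
hypotheses here, not discharged; nothing here is a statement about the Navier–Stokes equations and
NS regularity is NOT proved by anything in this file.
-/

noncomputable section

-- the sub-problem namespace repeats the summit name by design (D-0017)
set_option linter.dupNamespace false

namespace Summit.NavierStokesRegularity.NavierStokesRegularity.Theorems

/-- **Item stmt-NavierStokesRegularity-22416 (`ExactWindowRungThree.TransferBootstrap`).**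
`ExactFlowCertificate → TailEnvelopes → RobustStep data at ε₀ = 1`, as the composite of the
shadowing transfer (K1a ⇒ K1, item stmt-22924) and the trapping bootstrap (K1 → K2 → RobustStep,
item stmt-21749) of the sibling route `TrappingWindowRungThree`.  MODEL lattice statement; nothing
about Navier–Stokes is concluded. [cite: Tao2016AveragedNS, §6.4 Prop. 6.5 (shape of the robust
step); route ExactWindowRungThree, item S1′] -/
theorem exactWindowRungThree_transferBootstrap_proof :
    Summit.NavierStokesRegularity.NavierStokesRegularity.Theses.ExactWindowRungThree.TransferBootstrap := by
  unfold Summit.NavierStokesRegularity.NavierStokesRegularity.Theses.ExactWindowRungThree.TransferBootstrap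
  intro hK1a hK2
  unfold Summit.NavierStokesRegularity.NavierStokesRegularity.Theses.ExactWindowRungThree.ExactFlowCertificate
    at hK1a
  unfold Summit.NavierStokesRegularity.NavierStokesRegularity.Theses.ExactWindowRungThree.TailEnvelopes
    at hK2
  have hT := trappingWindowRungThree_shadowingTransfer_proof
  unfold Summit.NavierStokesRegularity.NavierStokesRegularity.Theses.TrappingWindowRungThree.ShadowingTransfer
    at hT
  have hK1 :
      Summit.NavierStokesRegularity.NavierStokesRegularity.Theses.TrappingWindowRungThree.WindowCertificate :=
    hT hK1a
  have hK2' :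
      Summit.NavierStokesRegularity.NavierStokesRegularity.Theses.TrappingWindowRungThree.TailEnvelopes := by
    unfold Summit.NavierStokesRegularity.NavierStokesRegularity.Theses.TrappingWindowRungThree.TailEnvelopes
    exact hK2
  have hB := trappingWindowRungThree_trappingBootstrap_proof
  unfold Summit.NavierStokesRegularity.NavierStokesRegularity.Theses.TrappingWindowRungThree.TrappingBootstrap
    at hB
  exact hB hK1 hK2'

end Summit.NavierStokesRegularity.NavierStokesRegularity.Theorems

end
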